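import Summits.PneNP.PneNP.Theorems.SymmetryBudgetNoHiddenOrderDecodeWalk
import Summits.PneNP.PneNP.Theorems.SymmetryBudgetNoHiddenOrderBitValuation
import Summits.PneNP.PneNP.Theorems.SymmetryBudgetNoHiddenOrderReplayIterDefs
import Summits.PneNP.PneNP.Theorems.SymmetryBudgetNoHiddenOrderPerPathAtoms
import Summits.PneNP.PneNP.Theorems.SymmetryBudgetNoHiddenOrderPerPathProcess

/-!
# `NoHiddenOrder` (stmt-PneNP-14781), (R2c) value layer II: invariants of the walk, certification of parts, unfolding `val`

Route `PneNP/SymmetryBudget`; continues `SymmetryBudgetNoHiddenOrderDecodeWalk.lean`.  Three facts the gate-level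
realisation of the certified-label scheme rests on:

* `WInv` — along the walk from a well-formed, equitable start the block stays NON-EMPTY, the colours stay `< n` (the bit
  valuation's `Wf`) and the colouring stays EQUITABLE inside the block (`winv_walk`); consequently a live state that is
  neither a section nor an individualisation node is a SINGLETON (`card_eq_one_of_leaf`: a singleton smallest cell of an
  equitable colouring is switching-isolated) — the only leaves the gates must read;
* `replay_part` — CERTIFICATION OF PARTS IS AUTOMATIC: if `L` replays to a section node `I`, every part label
  `L.part J.block` (`J` a part of `I`) replays to `J`; so the section case of `CertifiedLabels.val` reads the part groups
  unconditionally (`val_andNode_cg`);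
* `val_none` / `val_leaf` / `val_orNode` — the other cases of `CertifiedLabels.val`, unfolded (any process, any valuation).
Sorry-free; supports stmt-PneNP-14781.
-/

set_option linter.dupNamespace false -- `Summit.PneNP.PneNP.…` (D-0017 single-conjunct layout)

namespace Summit.PneNP.PneNP.Theorems

open Finset BranchSum

namespace CGBits

open WState

variable {V : Type*} [DecidableEq V] {G : SimpleGraph V} [DecidableRel G.Adj] {L : CertifiedLabels.Label V} {n : ℕ}

/-! ### The invariant -/

variable (G n) in
/-- The INVARIANT of walk states: non-empty block, colours `< n` inside it, equitable inside it. [folklore] -/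
structure WInv (S : WState V) : Prop where
  /-- the block is non-empty -/
  ne : S.A.Nonempty
  /-- colours inside the block are `< n` -/
  wf : ∀ u ∈ S.A, S.col u < n
  /-- the colouring is equitable inside the block -/
  eqIn : EqIn G S.A S.col

/-- Under `AndOK`, every point of `U` lies in the block and `andBlock` is its component. [folklore] -/
theorem andBlock_eq {S : WState V} (hok : AndOK G L S) {u₀ : V} (hu₀ : u₀ ∈ L.U) :
    u₀ ∈ S.A ∧ andBlock G L S = swReach G S.A S.col u₀ := by
  have hu₀A : u₀ ∈ S.A := swReach_subset _ _ _ (hok.2 u₀ hu₀ u₀ hu₀)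
  refine ⟨hu₀A, ?_⟩
  ext w
  unfold andBlock
  simp only [mem_filter]
  constructor
  · rintro ⟨-, u, hu, hw⟩
    have huA : u ∈ S.A := swReach_subset _ _ _ (hok.2 u hu u hu)
    rw [swReach_eq_of_mem _ huA (hok.2 u hu u₀ hu₀)]
    exact hw
  · intro hw
    exact ⟨swReach_subset _ _ _ hw, u₀, hu₀, hw⟩

/-- **The invariant is preserved by a step.** [folklore] -/
theorem winv_wstep [Fintype V] (hn : Fintype.card V ≤ n) {S : WState V} (h : WInv G n S) : WInv G n (wstep G L S) := by
  unfold wstep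
  split_ifs with hd hst hA hok hO hdom
  · exact h
  · exact h
  · -- AND-step: pass to the component of `U`
    obtain ⟨u₀, hu₀⟩ := hok.1
    obtain ⟨hu₀A, hblock⟩ := andBlock_eq hok hu₀
    have hsub : swReach G S.A S.col u₀ ⊆ S.A := swReach_subset _ _ _
    refine ⟨⟨u₀, ?_⟩, fun u hu => h.wf u (hsub (hblock ▸ hu)), ?_⟩
    · show u₀ ∈ andBlock G L S
      rw [hblock]; exact self_mem_swReach _ hu₀A
    · show EqIn G (andBlock G L S) S.col
      rw [hblock]
      intro u hu v hv huv w hw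
      exact equitableIn_of_swClosed G hsub (fun a ha b hb hab => swReach_closed _ u₀ ha hb hab) h.eqIn hu hv huv hw
  · exact ⟨h.ne, h.wf, h.eqIn⟩
  · -- OR-step: refine inside the block
    refine ⟨h.ne, fun u hu => ?_, fun u hu v hv huv w hw => ?_⟩
    · exact (refineIn_lt_card _ hu).trans_le ((card_le_univ _).trans hn)
    · exact equitableIn_refineIn S.A _ hu hv huv hw
  · exact ⟨h.ne, h.wf, h.eqIn⟩
  · exact ⟨h.ne, h.wf, h.eqIn⟩

/-- **The invariant holds along the walk.** [folklore] -/
theorem winv_walk [Fintype V] (hn : Fintype.card V ≤ n) {S : WState V} (h : WInv G n S) (k : ℕ) :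
    WInv G n (walk G L S k) := by
  induction k with
  | zero => exact h
  | succ k ih =>
    unfold walk
    rw [Function.iterate_succ_apply']
    exact winv_wstep hn ih

/-- The start at a refined non-empty block satisfies the invariant. [folklore] -/
theorem winv_start_refineIn [Fintype V] (hn : Fintype.card V ≤ n) {A : Finset V} (hA : A.Nonempty) (c : V → ℕ)
    (C : Finset V) : WInv G n (start (⟨(A, refineIn G A c), hA⟩ : CGInst V) C) :=
  ⟨hA, fun _ hu => (refineIn_lt_card _ hu).trans_le ((card_le_univ _).trans hn),
    fun _ hu _ hv huv _ hw => equitableIn_refineIn A c hu hv huv hw⟩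

/-! ### Leaves are singletons -/

/-- **A live state of the invariant that is neither a section nor an individualisation node is a singleton**: with `≥ 2`
vertices and a connected switching graph, the first smallest cell of an equitable colouring has `≥ 2` vertices, because a
vertex alone in its cell is switching-isolated. [folklore] -/
theorem card_eq_one_of_leaf {S : WState V} (h : WInv G n S) (hA : ¬ IsAND G S) (hO : ¬ IsOR G S) : S.A.card = 1 := by
  have hpos : 0 < S.A.card := card_pos.2 h.ne
  by_contra hne1
  have h2 : 1 < S.A.card := by omega
  apply hO
  refine ⟨hA, h2, ?_⟩
  by_contra hsmall
  -- the first smallest cell is a singleton `{a}`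
  obtain ⟨a, ha⟩ := smallestCell_nonempty S.col h.ne
  have haA : a ∈ S.A := smallestCell_subset _ _ ha
  have hcell : cellOf S.A S.col a = {a} := by
    rw [← smallestCell_eq_cellOf _ ha]
    have hcard : (smallestCell S.A S.col).card = 1 := by
      have := card_pos.2 (⟨a, ha⟩ : (smallestCell S.A S.col).Nonempty); omega
    obtain ⟨b, hb⟩ := card_eq_one.1 hcard
    rw [hb] at ha ⊢
    rw [mem_singleton.1 ha]
  -- `a` is switching-isolated, so its component is `{a} ≠ A`
  have hiso : ∀ b ∈ S.A, ¬ (swGraph G S.A S.col).Adj a b := fun b hb => not_swAdj_of_cell_singleton h.eqIn haA hcell hb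
  have hreach : swReach G S.A S.col a ⊆ {a} :=
    swReach_subset_of_closed _ (mem_singleton_self a) fun x hx b hb hxb => by
      rw [mem_singleton.1 hx] at hxb
      exact absurd hxb (hiso b hb)
  apply hA
  refine ⟨a, haA, fun heq => ?_⟩
  have : S.A.card ≤ 1 := by rw [← heq]; exact (card_le_card hreach).trans (card_singleton a).le
  omega

/-! ### Certification of parts is automatic -/

/-- If a label replays to an instance, that instance has vertex set `U`, and `U` lies inside the start block. [folklore] -/
theorem replay_some_spec [Fintype V] {J₀ I : CGInst V} {C₀ : Finset V}
    (h : CertifiedLabels.replay (cgProcess G) L J₀ C₀ = some I) : I.1.1 = L.U ∧ L.U ⊆ J₀.1.1 := by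
  suffices key : ∀ m (J₀ : CGInst V) (C₀ : Finset V),
      J₀.1.1.card * (Fintype.card V + 1) + (Fintype.card V - C₀.card) = m →
        CertifiedLabels.replay (cgProcess G) L J₀ C₀ = some I → I.1.1 = L.U ∧ L.U ⊆ J₀.1.1 from key _ J₀ C₀ rfl h
  intro m
  induction m using Nat.strong_induction_on with
  | _ m ih =>
  intro J₀ C₀ hm h
  rw [CertifiedLabels.replay] at h
  split_ifs at h with hstop
  · cases h
    exact ⟨hstop.1, hstop.1 ▸ Subset.rfl⟩
  split at h
  · cases h
  · rename_i ps hstep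
    split_ifs at h with hc
    · have := ih _ ?_ hc.choose C₀ rfl h
      · exact ⟨this.1, this.2.trans hc.choose_spec.2.2.1⟩
      · have h1 := card_lt_card hc.choose_spec.2.2
        have h3 : (((cgProcess G).verts hc.choose).card + 1) * (Fintype.card V + 1) ≤
            ((cgProcess G).verts J₀).card * (Fintype.card V + 1) := Nat.mul_le_mul_right _ h1
        rw [← hm]
        change ((cgProcess G).verts hc.choose).card * _ + _ < ((cgProcess G).verts J₀).card * _ + _
        nlinarith
  · rename_i A ch hstep
    split_ifs at h with hc hg
    have := ih _ ?_ (ch hc.choose) (insert hc.choose C₀) rfl h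
    · refine ⟨this.1, this.2.trans ?_⟩
      exact hg.1.le
    · rw [← hm]
      change ((cgProcess G).verts (ch hc.choose)).card * _ + _ < ((cgProcess G).verts J₀).card * _ + _
      rw [hg.1]
      have h1 : (insert hc.choose C₀).card = C₀.card + 1 := card_insert_of_notMem hg.2
      have h2 : (insert hc.choose C₀).card ≤ Fintype.card V := card_le_univ _
      omega

/-- The part of a section node containing a given non-empty subset of a part's block is that part. [folklore] -/
theorem choose_part_eq {I J : CGInst V} (hs : cgStep G I = .andNode (cgParts G I)) (hJ : J ∈ cgParts G I)
    {U : Finset V} (hU : U.Nonempty) (hUJ : U ⊆ J.1.1)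
    (h : ∃ J' ∈ cgParts G I, U ⊆ (cgProcess G).verts J' ∧ (cgProcess G).verts J' ⊂ (cgProcess G).verts I) :
    h.choose = J := by
  by_contra hne
  obtain ⟨u, hu⟩ := hU
  exact disjoint_left.1 (cgStep_parts_disjoint (G := G) I _ hs _ h.choose_spec.1 _ hJ hne) (h.choose_spec.2.1 hu) (hUJ hu)

/-- **Certification of parts is automatic**: if `L` replays (from any start) to a section node `I` and `J` is a part of `I`,
then the part label `L.part J.block` replays to `J`. [folklore] -/
theorem replay_part [Fintype V] {J₀ I : CGInst V} {C₀ : Finset V}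
    (h : CertifiedLabels.replay (cgProcess G) L J₀ C₀ = some I) (hs : cgStep G I = .andNode (cgParts G I)) {J : CGInst V}
    (hJ : J ∈ cgParts G I) : CertifiedLabels.replay (cgProcess G) (L.part J.1.1) J₀ C₀ = some J := by
  have hdisc := (cgStep_eq_andNode_iff.1 hs).1
  have hJU : J.1.1 ⊂ I.1.1 := cgParts_ssubset hdisc hJ
  suffices key : ∀ m (J₀ : CGInst V) (C₀ : Finset V),
      J₀.1.1.card * (Fintype.card V + 1) + (Fintype.card V - C₀.card) = m →
        CertifiedLabels.replay (cgProcess G) L J₀ C₀ = some I →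
          CertifiedLabels.replay (cgProcess G) (L.part J.1.1) J₀ C₀ = some J from key _ J₀ C₀ rfl h
  intro m
  induction m using Nat.strong_induction_on with
  | _ m ih =>
  intro J₀ C₀ hm h
  obtain ⟨hIU, hUJ₀⟩ := replay_some_spec h
  rw [CertifiedLabels.replay] at h
  rw [CertifiedLabels.replay]
  split_ifs at h with hstop
  · -- `L` stops here: `J₀ = I`, one more section step for the part label
    cases h
    split_ifs with hst'
    · exact absurd hst'.1.symm hJU.ne
    · split
      · rename_i hstep'; exact absurd (hs.symm.trans hstep') (by simp)
      · rename_i ps hstep'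
        obtain ⟨-, rfl⟩ := cgStep_eq_andNode_iff.1 (show cgStep G I = _ from hstep')
        split_ifs with hex
        · refine (congrArg (fun K => CertifiedLabels.replay (cgProcess G) (L.part J.1.1) K C₀)
            (choose_part_eq hs hJ J.2 Subset.rfl hex)).trans ?_
          rw [CertifiedLabels.replay]
          split_ifs with h3
          · rfl
          · exact absurd ⟨rfl, hstop.2⟩ h3
        · exact absurd ⟨J, hJ, Subset.rfl, hJU⟩ hex
      · rename_i hstep'; exact absurd (hs.symm.trans hstep') (by simp)
  · -- `L` does not stop: neither does the part label (its `U` is smaller than `L.U ⊆ verts J₀`), same step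
    have hJJ₀ : J.1.1 ⊂ J₀.1.1 := hJU.trans_subset (hIU ▸ hUJ₀)
    split_ifs with hst'
    · exact absurd hst'.1.symm hJJ₀.ne
    split at h
    · cases h
    · rename_i ps hstep
      split_ifs at h with hc
      have hUc : L.U ⊆ (cgProcess G).verts hc.choose := hc.choose_spec.2.1
      have hIc : I.1.1 ⊆ (cgProcess G).verts hc.choose := fun u hu => hUc (by rw [← hIU]; exact hu)
      obtain ⟨-, rfl⟩ := cgStep_eq_andNode_iff.1 (show cgStep G J₀ = _ from hstep)
      split_ifs with hex
      · have hsame : hex.choose = hc.choose :=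
          choose_part_eq hstep hc.choose_spec.1 J.2 (hJU.le.trans hIc) hex
        refine (congrArg (fun K => CertifiedLabels.replay (cgProcess G) (L.part J.1.1) K C₀) hsame).trans ?_
        refine ih _ ?_ hc.choose C₀ rfl h
        have h1 := card_lt_card hc.choose_spec.2.2
        have h3 : (((cgProcess G).verts hc.choose).card + 1) * (Fintype.card V + 1) ≤
            ((cgProcess G).verts J₀).card * (Fintype.card V + 1) := Nat.mul_le_mul_right _ h1
        rw [← hm]
        change ((cgProcess G).verts hc.choose).card * _ + _ < ((cgProcess G).verts J₀).card * _ + _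
        nlinarith
      · exact absurd ⟨hc.choose, hc.choose_spec.1, hJU.le.trans hIc, hc.choose_spec.2.2⟩ hex
    · rename_i A ch hstep
      split_ifs at h with hc hg
      -- the choice data of the part label are those of `L` (definitionally)
      split_ifs with hc' hg'
      · have hx : hc'.choose = hc.choose := rfl
        refine (congrArg (fun x => CertifiedLabels.replay (cgProcess G) (L.part J.1.1) (ch x) (insert x C₀)) hx).trans ?_
        refine ih _ ?_ (ch hc.choose) (insert hc.choose C₀) rfl h
        rw [← hm]
        change ((cgProcess G).verts (ch hc.choose)).card * _ + _ < ((cgProcess G).verts J₀).card * _ + _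
        rw [hg.1]
        have h1 : (insert hc.choose C₀).card = C₀.card + 1 := card_insert_of_notMem hg.2
        have h2 : (insert hc.choose C₀).card ≤ Fintype.card V := card_le_univ _
        omega
      · exact absurd hg hg'
      · exact absurd hc hc'

/-! ### Unfolding `val` -/

section Val

variable [Fintype V] (P : CertifiedLabels.Process V) {Val : Type*} [DecidableEq Val] (Vn : CertifiedLabels.Valuation P Val)
  (dec : CertifiedLabels.Label V → Option P.Inst) (adm : CertifiedLabels.Label V → Prop) (g : ℕ)

omit [DecidableRel G.Adj] in
/-- A label that does not decode has no value. [folklore] -/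
theorem val_none {L : CertifiedLabels.Label V} (hdec : dec L = none) : CertifiedLabels.val P Vn dec adm g L = none := by
  rw [CertifiedLabels.val]
  split
  · rfl
  · rename_i I hI; rw [hdec] at hI; cases hI

omit [DecidableRel G.Adj] in
/-- **The value at a leaf.** [folklore] -/
theorem val_leaf {L : CertifiedLabels.Label V} {I : P.Inst} (hdec : dec L = some I) (hstep : P.step I = .leaf) :
    CertifiedLabels.val P Vn dec adm g L = some (Vn.leafVal I) := by
  rw [CertifiedLabels.val]
  split
  · rename_i hI; rw [hdec] at hI; cases hI
  · rename_i I' hI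
    rw [hdec] at hI
    cases hI
    split
    · rfl
    · rename_i hstep'; rw [hstep] at hstep'; cases hstep'
    · rename_i hstep'; rw [hstep] at hstep'; cases hstep'

omit [DecidableRel G.Adj] in
open scoped Classical in
/-- **The value at an individualisation node**: the choice among the lifted values of the admissible, certified, valued
candidates. [folklore] -/
theorem val_orNode {L : CertifiedLabels.Label V} {I : P.Inst} {A : Finset V} {ch : V → P.Inst} (hdec : dec L = some I)
    (hstep : P.step I = .orNode A ch) :
    CertifiedLabels.val P Vn dec adm g L =
      Vn.pick ((A.filter fun x => x ∉ L.X).attach.biUnion fun x =>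
        (range g).biUnion fun v =>
          if adm (L.cand x.1 v) ∧ dec (L.cand x.1 v) = some (ch x.1) then
            ((CertifiedLabels.val P Vn dec adm g (L.cand x.1 v)).map (Vn.lift I x.1)).toFinset
          else ∅) := by
  rw [CertifiedLabels.val]
  split
  · rename_i hI; rw [hdec] at hI; cases hI
  · rename_i I' hI
    rw [hdec] at hI
    cases hI
    split
    · rename_i hstep'; rw [hstep] at hstep'; cases hstep'
    · rename_i hstep'; rw [hstep] at hstep'; cases hstep'
    · rename_i A' ch' hstep'
      rw [hstep] at hstep'
      cases hstep'
      rfl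

end Val

/-- **The value at a section node of the concrete process, with the replay decoding**: all part groups are read
unconditionally (their certification is automatic); the node has a value iff all of them do, and then it is the pasting of
their values (for a pasting operation that reads only the parts, as every realised one does). [folklore] -/
theorem val_andNode_cg [Fintype V] {Val : Type*} [DecidableEq Val] (Vn : CertifiedLabels.Valuation (cgProcess G) Val)
    (adm : CertifiedLabels.Label V → Prop) (g : ℕ) (I₀ : CGInst V) {L : CertifiedLabels.Label V} {I : CGInst V}
    (hdec : CertifiedLabels.replay (cgProcess G) L I₀ ∅ = some I) (hs : cgStep G I = .andNode (cgParts G I))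
    (hpaste : ∀ f f' : CGInst V → Val, (∀ J ∈ cgParts G I, f J = f' J) → Vn.paste I f = Vn.paste I f') :
    CertifiedLabels.val (cgProcess G) Vn (fun L => CertifiedLabels.replay (cgProcess G) L I₀ ∅) adm g L =
      if ∀ J ∈ cgParts G I, CertifiedLabels.val (cgProcess G) Vn (fun L => CertifiedLabels.replay (cgProcess G) L I₀ ∅) adm g
          (L.part J.1.1) ≠ none then
        some (Vn.paste I fun J => (CertifiedLabels.val (cgProcess G) Vn
          (fun L => CertifiedLabels.replay (cgProcess G) L I₀ ∅) adm g (L.part J.1.1)).getD (Vn.leafVal J))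
      else none := by
  classical
  obtain ⟨hIU, -⟩ := replay_some_spec hdec
  have hdisc := (cgStep_eq_andNode_iff.1 hs).1
  -- the reading `r J` of a part is the part group's value
  have hr : ∀ J ∈ cgParts G I,
      (if _hJU : (cgProcess G).verts J ⊂ L.U then
        (if CertifiedLabels.replay (cgProcess G) (L.part ((cgProcess G).verts J)) I₀ ∅ = some J then
          CertifiedLabels.val (cgProcess G) Vn (fun L => CertifiedLabels.replay (cgProcess G) L I₀ ∅) adm g
            (L.part ((cgProcess G).verts J)) else none)
      else none) =
      CertifiedLabels.val (cgProcess G) Vn (fun L => CertifiedLabels.replay (cgProcess G) L I₀ ∅) adm g (L.part J.1.1) := by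
    intro J hJ
    have hJU : (cgProcess G).verts J ⊂ L.U := hIU ▸ cgParts_ssubset hdisc hJ
    rw [dif_pos hJU, if_pos (show CertifiedLabels.replay (cgProcess G) (L.part ((cgProcess G).verts J)) I₀ ∅ = some J from
      replay_part hdec hs hJ)]
    rfl
  rw [CertifiedLabels.val]
  split
  · rename_i hI; exact absurd (hdec.symm.trans hI) (by simp)
  · rename_i I' hI
    have hII : I' = I := Option.some.inj (hI.symm.trans hdec)
    subst hII
    split
    · rename_i hstep'; exact absurd (hs.symm.trans hstep') (by simp)
    · rename_i ps hstep'
      obtain ⟨-, rfl⟩ := cgStep_eq_andNode_iff.1 (show cgStep G I' = _ from hstep')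
      dsimp only
      have hcond : (∀ J ∈ cgParts G I', (if _hJU : (cgProcess G).verts J ⊂ L.U then
          (if CertifiedLabels.replay (cgProcess G) (L.part ((cgProcess G).verts J)) I₀ ∅ = some J then
            CertifiedLabels.val (cgProcess G) Vn (fun L => CertifiedLabels.replay (cgProcess G) L I₀ ∅) adm g
              (L.part ((cgProcess G).verts J)) else none) else none).isSome = true) ↔
          ∀ J ∈ cgParts G I', CertifiedLabels.val (cgProcess G) Vn (fun L => CertifiedLabels.replay (cgProcess G) L I₀ ∅) adm g
            (L.part J.1.1) ≠ none := by
        refine forall₂_congr fun J hJ => ?_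
        rw [hr J hJ, Option.isSome_iff_ne_none]
      split_ifs with h1 h2 h2
      · congr 1
        exact hpaste _ _ fun J hJ => congrArg (fun o => Option.getD o (Vn.leafVal J)) (hr J hJ)
      · exact absurd (hcond.1 h1) h2
      · exact absurd (hcond.2 h2) h1
      · rfl
    · rename_i hstep'; exact absurd (hs.symm.trans hstep') (by simp)

end CGBits

end Summit.PneNP.PneNP.Theorems
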